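import Literature.AlgebraicGeometry.Morphisms.UpperSemicontinuityH0
import Literature.AlgebraicGeometry.KTheory.PullbackVectorBundle
import HarnessLib

/-!
# Upper semicontinuity of `h⁰` in a proper flat family over ANY locally noetherian base (Zariski-local form)

Topic `Literature/AlgebraicGeometry/Morphisms`; theorems only (no definition, no named fact, no instance, no notation, no
`sorry`).  Cell hodgecm-mathlib, F-DAG F-6 (I) brick U2b (census `B-provers/B-p15/g12/CENSUS-F6I-GeomConnectedOpen.B-p15g12.md`,
glue (G-c) «globalisation by an affine cover»).  Sequel to ★ `Morphisms/UpperSemicontinuityH0` (the AFFINE base: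
`isOpen_setOf_finrank_secMod_fiber_lt`, `finrank_secMod_fieldPoint_eq_finrank_secMod_fiber`).  HC_CM is proved only modulo the
7 printed citations until rung 0 closes; nothing here bears on a summit statement.

For `p : X ⟶ S` proper and flat, `S` locally noetherian (not necessarily affine), `G` finite locally free on `X`, and `s ∈ S`,
write `h⁰(s) := finrank_{Γ(Spec κ(s), 𝒪)} Γ(p.fiber s, (p.fiberι s)^* G)` (Mathlib `Scheme.Hom.fiber`, the sections as a
`Γ(Spec κ(s), 𝒪)`-module `SecMod _ (p.fiberToSpecResidueField s)♯ ⊤`, ★ `Modules/ModuleCechComplex.SecMod`).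

* §1 `nonempty_secMod_linearEquiv_of_iso`, `finrank_secMod_eq_of_iso` — an isomorphism of `𝒪`-modules induces a linear
  equivalence of global sections over any ring of scalars `ρ : R → Γ(Y, 𝒪)` (bookkeeping; the `private` lemma of ★
  `Morphisms/SectionsBaseChangeThroughPrime`, made citable);
* §2 RESTRICTION TO AN OPEN `U ⊆ S`: the fibre square of `p` at `s ∈ U` lifts to a cartesian square over `U` for `p ∣_ U`
  (`isPullback_lift_fiberι_morphismRestrict`: Mathlib `IsOpenImmersion.lift` + `isPullback_morphismRestrict` + `IsPullback.of_right`),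
  whence **`finrank_secMod_fiber_morphismRestrict_eq`**: `h⁰` of `p ∣_ U` (module `G|_{p⁻¹U}`) at `u` equals `h⁰` of `p` at `u`
  (★ `finrank_secMod_fieldPoint_eq_finrank_secMod_fiber` on the affine `U` + §1 along `(lift)^*(ι^*G) ≅ (p.fiberι s)^*G`);
* §3 **`isOpen_setOf_finrank_secMod_fiber_lt_of_isLocallyNoetherian`** / **`isClosed_setOf_le_finrank_secMod_fiber_of_isLocallyNoetherian`**
  — `{s | h⁰(s) < n}` is open and `{s | n ≤ h⁰(s)}` is closed in ANY locally noetherian `S` (openness is local; affine opens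
  form a basis; ★ the affine case).

## References
* D. Mumford, *Abelian Varieties*, TIFR Studies in Mathematics 5 (1970), §5, Cor. 1 (p. 50). [MumfordAV1970]
* A. Grothendieck, EGA III₂ (Publ. Math. IHÉS 17, 1963), Thm. 7.7.5 (I). [EGAIII2]
* R. Hartshorne, *Algebraic Geometry*, GTM 52 (1977), III Thm. 12.8 (p. 288). [Hartshorne1977]
* U. Görtz, T. Wedhorn, *Algebraic Geometry I: Schemes*, 2nd ed. (2020), Section (4.7) (pp. 107–108) (base change along an
  open subscheme). [GortzWedhorn2020]
-/

noncomputable section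

set_option backward.isDefEq.respectTransparency false

open CategoryTheory CategoryTheory.Limits Opposite TopologicalSpace AlgebraicGeometry TensorProduct Module

universe u

namespace Literature.AlgebraicGeometry.Morphisms

open Literature.AlgebraicGeometry.Modules Literature.AlgebraicGeometry.Motives

/-! ## §1 Transport of global sections along an isomorphism of modules -/

section Transport

variable {Y : Scheme.{u}} {R : Type u} [CommRing R] (ρ : R →+* Γ(Y, ⊤)) {M N : Y.Modules}

/-- An isomorphism of `𝒪_Y`-modules induces an `R`-linear equivalence of the modules of global sections (`R` acting through
`ρ : R → Γ(Y, 𝒪)`), `x ↦ Φ(x)` (the `private` transport of ★ `Morphisms/SectionsBaseChangeThroughPrime`, made citable).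
[cite: GortzWedhorn2020, Section (4.7) (pp. 107–108)] -/
theorem nonempty_secMod_linearEquiv_of_iso (Φ : M ≅ N) :
    ∃ L : SecMod M ρ ⊤ ≃ₗ[R] SecMod N ρ ⊤,
      ∀ x, SecMod.val (L := N) (ρ := ρ) (L x) = Φ.hom.app ⊤ (SecMod.val (L := M) (ρ := ρ) x) := by
  refine ⟨{ toFun := fun x => SecMod.mk (ρ := ρ) (Φ.hom.app ⊤ (SecMod.val (L := M) (ρ := ρ) x))
            invFun := fun y => SecMod.mk (ρ := ρ) (Φ.inv.app ⊤ (SecMod.val (L := N) (ρ := ρ) y))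
            map_add' := fun x y => by
              apply SecMod.val_injective (L := N) (ρ := ρ)
              change Φ.hom.app ⊤ (SecMod.val (L := M) (ρ := ρ) x + SecMod.val (L := M) (ρ := ρ) y) = _
              rw [map_add]
              rfl
            map_smul' := fun c x => by
              apply SecMod.val_injective (L := N) (ρ := ρ)
              change Φ.hom.app ⊤ (toSections ρ ⊤ c • SecMod.val (L := M) (ρ := ρ) x) =
                toSections ρ ⊤ c • Φ.hom.app ⊤ (SecMod.val (L := M) (ρ := ρ) x)
              rw [Scheme.Modules.Hom.app_smul]
            left_inv := fun x => by
              apply SecMod.val_injective (L := M) (ρ := ρ)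
              change Φ.inv.app ⊤ (Φ.hom.app ⊤ (SecMod.val (L := M) (ρ := ρ) x)) = _
              rw [inv_app_hom_app]
            right_inv := fun y => by
              apply SecMod.val_injective (L := N) (ρ := ρ)
              change Φ.hom.app ⊤ (Φ.inv.app ⊤ (SecMod.val (L := N) (ρ := ρ) y)) = _
              rw [hom_app_inv_app] }, fun x => rfl⟩

/-- Isomorphic `𝒪_Y`-modules have global sections of the same rank over any ring of scalars `ρ : R → Γ(Y, 𝒪)`.
[cite: GortzWedhorn2020, Section (4.7) (pp. 107–108)] -/
theorem finrank_secMod_eq_of_iso (Φ : M ≅ N) : finrank R (SecMod M ρ ⊤) = finrank R (SecMod N ρ ⊤) := by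
  obtain ⟨L, -⟩ := nonempty_secMod_linearEquiv_of_iso ρ Φ
  exact L.finrank_eq

end Transport

/-! ## §2 Restriction of the family to an open subscheme of the base -/

section Restrict

variable {X S : Scheme.{0}} (p : X ⟶ S) (G : X.Modules) (U : S.Opens)

/-- The canonical field point `Spec κ(s) → S` of a point `s ∈ U` lands in `U`. [cite: GortzWedhorn2020, Section (4.7) (pp. 107–108)] -/
theorem range_fromSpecResidueField_subset_range_ι {s : S} (hs : s ∈ U) :
    Set.range (S.fromSpecResidueField s).base ⊆ Set.range U.ι.base := by
  rintro _ ⟨x, rfl⟩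
  rw [Scheme.fromSpecResidueField_apply, Scheme.Opens.range_ι]
  exact hs

/-- The fibre `p.fiber s ⟶ X` of a point `s ∈ U` lands in `p⁻¹U`. [cite: GortzWedhorn2020, Section (4.7) (pp. 107–108)] -/
theorem range_fiberι_subset_range_ι {s : S} (hs : s ∈ U) :
    Set.range (p.fiberι s).base ⊆ Set.range (p ⁻¹ᵁ U).ι.base := by
  rw [Scheme.Hom.range_fiberι, Scheme.Opens.range_ι]
  rintro x (hx : p.base x = s)
  change p.base x ∈ U
  rw [hx]
  exact hs

/-- The lift `Spec κ(s) → U` of the canonical field point hits the point `u` of `U` lying over `s`.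
[cite: GortzWedhorn2020, Section (4.7) (pp. 107–108)] -/
theorem lift_fromSpecResidueField_base (u : U) (pt : Spec (S.residueField (U.ι.base u))) :
    (IsOpenImmersion.lift U.ι (S.fromSpecResidueField (U.ι.base u))
      (range_fromSpecResidueField_subset_range_ι U (by rw [Scheme.Opens.ι_apply]; exact u.2))).base pt = u := by
  apply U.ι.isOpenEmbedding.injective
  rw [← Scheme.Hom.comp_apply, IsOpenImmersion.lift_fac, Scheme.fromSpecResidueField_apply]

/-- **The fibre square of `p` at `s ∈ U`, lifted to `U`, is cartesian for `p ∣_ U`**: with `fst′ : p.fiber s → p⁻¹U` and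
`y′ : Spec κ(s) → U` the lifts through the open immersions, `IsPullback fst′ (p.fiberToSpecResidueField s) (p ∣_ U) y′`
(Mathlib `isPullback_morphismRestrict` + `IsPullback.of_right`). [cite: GortzWedhorn2020, Section (4.7) (pp. 107–108)] -/
theorem isPullback_lift_fiberι_morphismRestrict {s : S} (hs : s ∈ U) :
    IsPullback (IsOpenImmersion.lift (p ⁻¹ᵁ U).ι (p.fiberι s) (range_fiberι_subset_range_ι p U hs))
      (p.fiberToSpecResidueField s) (p ∣_ U)
      (IsOpenImmersion.lift U.ι (S.fromSpecResidueField s) (range_fromSpecResidueField_subset_range_ι U hs)) := by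
  have big : IsPullback (IsOpenImmersion.lift (p ⁻¹ᵁ U).ι (p.fiberι s) (range_fiberι_subset_range_ι p U hs) ≫ (p ⁻¹ᵁ U).ι)
      (p.fiberToSpecResidueField s) p
      (IsOpenImmersion.lift U.ι (S.fromSpecResidueField s) (range_fromSpecResidueField_subset_range_ι U hs) ≫ U.ι) := by
    rw [IsOpenImmersion.lift_fac, IsOpenImmersion.lift_fac]
    exact IsPullback.of_hasPullback p (S.fromSpecResidueField s)
  refine big.of_right ?_ (isPullback_morphismRestrict p U).flip
  apply (cancel_mono U.ι).mp
  rw [Category.assoc, Category.assoc, IsOpenImmersion.lift_fac, (isPullback_morphismRestrict p U).w, ← Category.assoc,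
    IsOpenImmersion.lift_fac]
  exact p.fiber_fac s

/-- **`h⁰` of the restricted family `p ∣_ U` (module `G|_{p⁻¹U}`) at `u` equals `h⁰` of `p` at `u`**, for `U ⊆ S` an affine open
of a locally noetherian `S` and `p` proper flat, `G` finite locally free (★ `finrank_secMod_fieldPoint_eq_finrank_secMod_fiber` for
`p ∣_ U` on the lifted square + §1 along `fst′^*(ι^*G) ≅ (fst′ ≫ ι)^*G = (p.fiberι s)^*G`). [cite: MumfordAV1970, §5 Cor. 1 (p. 50)]
[cite: GortzWedhorn2020, Section (4.7) (pp. 107–108)] -/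
theorem finrank_secMod_fiber_morphismRestrict_eq (hU : IsAffineOpen U) [IsProper p] [Flat p] [IsLocallyNoetherian S]
    (hL : IsFiniteLocallyFree G) (u : U) :
    finrank Γ(Spec ((U : Scheme.{0}).residueField u), ⊤)
        (SecMod ((Scheme.Modules.pullback ((p ∣_ U).fiberι u)).obj ((Scheme.Modules.pullback (p ⁻¹ᵁ U).ι).obj G))
          ((p ∣_ U).fiberToSpecResidueField u).appTop.hom ⊤) =
      finrank Γ(Spec (S.residueField (U.ι.base u)), ⊤)
        (SecMod ((Scheme.Modules.pullback (p.fiberι (U.ι.base u))).obj G)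
          (p.fiberToSpecResidueField (U.ι.base u)).appTop.hom ⊤) := by
  haveI : IsAffine U := hU
  have hs : U.ι.base u ∈ U := by rw [Scheme.Opens.ι_apply]; exact u.2
  have H := isPullback_lift_fiberι_morphismRestrict p U hs
  -- `h⁰` of `p ∣_ U` at `u` is computed on the lifted square (★ affine invariance)
  rw [← finrank_secMod_fieldPoint_eq_finrank_secMod_fiber (p ∣_ U) ((Scheme.Modules.pullback (p ⁻¹ᵁ U).ι).obj G)
    (hL.pullback _) _ (IsLocalRing.closedPoint _) u (lift_fromSpecResidueField_base U u _) _ _ H]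
  -- transport along `fst′^*(ι^*G) ≅ (p.fiberι s)^*G`
  exact finrank_secMod_eq_of_iso _
    ((Scheme.Modules.pullbackComp _ (p ⁻¹ᵁ U).ι).app G ≪≫
      (Scheme.Modules.pullbackCongr (IsOpenImmersion.lift_fac (p ⁻¹ᵁ U).ι (p.fiberι (U.ι.base u))
        (range_fiberι_subset_range_ι p U hs))).app G)

end Restrict

/-! ## §3 Upper semicontinuity of `h⁰` over any locally noetherian base -/

section Global

variable {X S : Scheme.{0}} (p : X ⟶ S) [IsProper p] [Flat p] [IsLocallyNoetherian S] (G : X.Modules)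
  (hL : IsFiniteLocallyFree G)

include hL in
/-- **UPPER SEMICONTINUITY OF `h⁰`, ANY LOCALLY NOETHERIAN BASE (open form)**: for `p : X → S` proper and flat and `G` finite
locally free, `{s | h⁰(s) < n}` is OPEN in `S`, `h⁰(s) = finrank_{Γ(Spec κ(s), 𝒪)} Γ(p.fiber s, G|)` (openness is local: on each
affine open `U` it is the open set of ★ `isOpen_setOf_finrank_secMod_fiber_lt` for `p ∣_ U`, transported by §2).
[cite: MumfordAV1970, §5 Cor. 1 (p. 50)] [cite: EGAIII2, 7.7.5 (I)] [cite: Hartshorne1977, III Thm. 12.8 (p. 288)] -/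
theorem isOpen_setOf_finrank_secMod_fiber_lt_of_isLocallyNoetherian (n : ℕ) :
    IsOpen {s : S | finrank Γ(Spec (S.residueField s), ⊤)
      (SecMod ((Scheme.Modules.pullback (p.fiberι s)).obj G) (p.fiberToSpecResidueField s).appTop.hom ⊤) < n} := by
  rw [isOpen_iff_forall_mem_open]
  intro s hs
  obtain ⟨_, ⟨U', hU, rfl⟩, hsU, -⟩ := S.isBasis_affineOpens.exists_subset_of_mem_open (Set.mem_univ s) isOpen_univ
  let U : S.Opens := U'
  haveI : IsAffine U := hU
  let ZU : Set U := {u : U | finrank Γ(Spec ((U : Scheme.{0}).residueField u), ⊤)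
    (SecMod ((Scheme.Modules.pullback ((p ∣_ U).fiberι u)).obj ((Scheme.Modules.pullback (p ⁻¹ᵁ U).ι).obj G))
      ((p ∣_ U).fiberToSpecResidueField u).appTop.hom ⊤) < n}
  have hZU : IsOpen ZU := isOpen_setOf_finrank_secMod_fiber_lt (p ∣_ U) _ (hL.pullback _) n
  refine ⟨U.ι.base '' ZU, ?_, U.ι.isOpenEmbedding.isOpenMap _ hZU, ?_⟩
  · rintro _ ⟨u, hu, rfl⟩
    change _ < n
    rw [← finrank_secMod_fiber_morphismRestrict_eq p G U hU hL u]
    exact hu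
  · obtain ⟨u, rfl⟩ : s ∈ Set.range U.ι.base := by rw [Scheme.Opens.range_ι]; exact hsU
    refine ⟨u, ?_, rfl⟩
    change _ < n
    rw [finrank_secMod_fiber_morphismRestrict_eq p G U hU hL u]
    exact hs

include hL in
/-- **UPPER SEMICONTINUITY OF `h⁰`, ANY LOCALLY NOETHERIAN BASE (closed form)**: `{s | n ≤ h⁰(s)}` is CLOSED in `S`.
[cite: MumfordAV1970, §5 Cor. 1 (p. 50)] [cite: EGAIII2, 7.7.5 (I)] [cite: Hartshorne1977, III Thm. 12.8 (p. 288)] -/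
theorem isClosed_setOf_le_finrank_secMod_fiber_of_isLocallyNoetherian (n : ℕ) :
    IsClosed {s : S | n ≤ finrank Γ(Spec (S.residueField s), ⊤)
      (SecMod ((Scheme.Modules.pullback (p.fiberι s)).obj G) (p.fiberToSpecResidueField s).appTop.hom ⊤)} := by
  have h := isOpen_setOf_finrank_secMod_fiber_lt_of_isLocallyNoetherian p G hL n
  rw [← isOpen_compl_iff]
  convert h using 1
  ext s
  simp only [Set.mem_compl_iff, Set.mem_setOf_eq, not_le]

end Global

end Literature.AlgebraicGeometry.Morphisms

end
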